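import Summits.BirchSwinnertonDyer.BirchSwinnertonDyer.Theses.PrintCFram
import Summits.BirchSwinnertonDyer.BirchSwinnertonDyer.Theorems.GoldfeldAllTwistsTwoConverseTwinBirchLemmaKrizLi7
import Summits.BirchSwinnertonDyer.BirchSwinnertonDyer.Theorems.PrintCFramBottomClassIndexLawFiveLeBernoulliKummerDictionary
import Summits.BirchSwinnertonDyer.Rank1Residual.X11b.BDPRoute
import Literature.NumberTheory.EllipticCurves.KrizLi2019.EisensteinHeegnerLog
import Literature.NumberTheory.EllipticCurves.ComplexMultiplicationTwistIsogenyProofs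
import Literature.NumberTheory.EllipticCurves.HeegnerPoints
import Literature.NumberTheory.LFunctions.GeneralizedBernoulliNumbers
import Literature.NumberTheory.EllipticCurves.Rank1Residual.Predicates
import HarnessLib

set_option linter.dupNamespace false
set_option autoImplicit false

/-!
# Sketch v2 — crux idea «genus-internal Heegner fields» for `PrintCFram.BottomClassIndexLawFiveLe`
(stmt-BirchSwinnertonDyer-20372; ideator bsd-idea-7 g20; answers critic idea-crit-10 V#146 prices P1/P2;
nothing here is a statement about BSD — BSD is not proved by any of this; no stub of the LEAD's registered
skeleton is touched; this file is a crux WORKFILE, not a line.)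

* §0 the two First-lemma predicates of g19, VERBATIM (`TwistingFieldSevenBSDp`, `StrippedDatumBSDp`).
* §1 **P1 PAID (proved, sorry-free):** the `K`-general twin of bsd-goldfeld's
  `GoldfeldGoodTwists.not_isOfFinAddOrder_heegnerPoint_cm7_of_thm120` — Kriz–Li 2019 Thm. 1.20 at
  `(E, p, ψ) = (X₀(49) = cm7, 7, ω²)` for EVERY imaginary quadratic `K` with the Heegner hypothesis for `49`
  (no condition on `d_K` beyond `NeZero`), the Bernoulli hypothesis discharged by CLASS REGULARITY
  `7 ∤ B_{5,ε_K}/5` ALONE: second factor `‖B_{1,ω}‖₇ = 1` (`RouteU.norm_bernoulliOnePrim_teichmuller_seven` via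
  `norm_bernoulliOnePrim_bernoulliCharTwo_teichmuller_sq`), first factor `B_{1,ε_Kω⁴} ≡ B_{5,ε_K}/5 (mod 7)` by the
  cell's Kummer dictionary (`KummerDictionary.norm_bernoulliOnePrim_le_inv_iff_of_values`, w8 g3).
  `padicLogHeegner_unit_cm7_of_regular` = the conclusion of Thm. 1.20 (unit `7`-adic logarithm, any `ιp : K → ℚ₇`,
  any datum); `not_isOfFinAddOrder_heegnerPoint_cm7_of_regular` = every level-`49` Heegner point is non-torsion.
* §2 **P2 (typed, OPEN):** the ONE new piece of the assembly as a predicate, `IndexIdentityAtCm7SevenOfLogUnit`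
  (unit log + `7 ∤ c(Dt)` + rank one + `Ш(X₀(49)/K)[7] = 0` ⟹ `X11b.IndexIdentityAt cm7 7 K P`), the `hid` input of
  the tree's display provider `EisensteinPrimesMazurMCOnCellBTwistbackDisplay.displaySwap_of_indexIdentityAt`.
-/

noncomputable section

open scoped Classical NumberTheorySymbols

open WeierstrassCurve NumberField DirichletCharacter
open Literature
open Literature.NumberTheory Literature.NumberTheory.EllipticCurves
  Literature.NumberTheory.EllipticCurves.ModularForms
open Literature.NumberTheory.EllipticCurves.KrizLi2019 Literature.NumberTheory.LFunctions
open Literature.NumberTheory.EllipticCurves.Rank1Residual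
open Summit.BirchSwinnertonDyer.Rank1Residual
open Summit.BirchSwinnertonDyer.Rank1Residual.X12.O11.RouteU
open Summit.BirchSwinnertonDyer.BirchSwinnertonDyer.Theorems.GoldfeldGoodTwists
open Summit.BirchSwinnertonDyer.BirchSwinnertonDyer.Theorems.PrintCFram

namespace Summit.BirchSwinnertonDyer.BirchSwinnertonDyer.Cruxes.BottomClassIndexLawFiveLe.GenusInternalHeegnerFields

/-! ## §0 The two First-lemma predicates (g19, verbatim) -/

/-- FIRST LEMMA (p = 7, the datum `(X₀(49), K = ℚ(√e*))`, `D = e*`): for every imaginary quadratic `K`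
in which `7` splits (Heegner hypothesis for `49`) — i.e. every rank-one class `e` at `p = 7` with
`χ_{e*}(7) = +1` — CLASS REGULARITY ALONE (`7 ∤ B_{5,ε_K}/5`, Kummer-equivalent to `7 ∤ B_{1,ε_K ω⁴}`,
the `K''`-free Kriz–Li factor) gives Miller's `BSD(W,7)` at every globally minimal model `W` of
`X₀(49)^{(d_K)}` of analytic rank one. Inputs (to become binders of the stub): Kriz–Li Thm 1.20 for
`(cm7, 7, ψ = ω², K)` (its second Bernoulli factor `B_{1,ω}` is a `7`-unit), Gross–Zagier for `(cm7, K)`,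
Manin constant `1` for `X₀(49)`, `BSD(49a1,7)` (rank `0`), the cell's regular-member Selmer count. -/
def TwistingFieldSevenBSDp : Prop :=
  ∀ (K : Type) [Field K] [NumberField K] [NeZero (NumberField.discr K).natAbs],
    IsImaginaryQuadratic K → SatisfiesHeegnerHypothesis 49 K →
    ∀ (εK : DirichletCharacter ℚ_[7] (NumberField.discr K).natAbs), IsKroneckerCharacterOf K εK →
    ¬ ‖(5 : ℚ_[7])⁻¹ * generalizedBernoulli 5 εK‖ ≤ (7 : ℝ)⁻¹ →
    ∀ (W : WeierstrassCurve ℚ) [W.IsElliptic] [W.IsGloballyMinimal],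
      (∃ C : WeierstrassCurve.VariableChange ℚ, C • (cm7.quadraticTwist (NumberField.discr K : ℚ)) = W) →
      W.analyticRank = 1 → BSDp W 7

/-- FIRST LEMMA′ (general `p`, a STRIPPING `e* = D · c`, `D < 0`): the genus-internal datum
`(E = a minimal model of A(p)^{(c)}, K = ℚ(√D))` — Heegner for `N_E` with `p` split — has Kriz–Li
Bernoulli pair `reg(e) · B_{k,χ_c}/k`; so two Bernoulli units give `BSD(W,p)` for the rank-one class
member `W ≅ E^{(D)}`. Typed here in the registry's idiom (characters over `ℚ_[p]`, `k = (p+1)/4`). -/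
def StrippedDatumBSDp : Prop :=
  ∀ (p : ℕ) [Fact p.Prime], (p = 7 ∨ p = 11 ∨ p = 19 ∨ p = 43 ∨ p = 67 ∨ p = 163) →
  ∀ (E W : WeierstrassCurve ℚ) [E.IsElliptic] [E.IsGloballyMinimal] [W.IsElliptic] [W.IsGloballyMinimal],
    E.HasCM → CMRamified E p → E.analyticRank = 0 → W.analyticRank = 1 →
  ∀ (K : Type) [Field K] [NumberField K] [NeZero (NumberField.discr K).natAbs],
    IsImaginaryQuadratic K → SatisfiesHeegnerHypothesis (E.conductorNorm ℤ) K →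
    ((Ideal.span {(p : ℤ)}).primesOver (NumberField.RingOfIntegers K)).ncard = 2 →
    (∃ C : WeierstrassCurve.VariableChange ℚ, C • (E.quadraticTwist (NumberField.discr K : ℚ)) = W) →
  ∀ (mW mE : ℕ) [NeZero mW] [NeZero mE] (χW : DirichletCharacter ℚ_[p] mW) (χE : DirichletCharacter ℚ_[p] mE)
    (εK : DirichletCharacter ℚ_[p] (NumberField.discr K).natAbs),
    IsKroneckerCharacterOf K εK → χW.IsPrimitive → χW.IsQuadratic → χE.IsPrimitive → χE.IsQuadratic →
    mW.Coprime p → (mE * (NumberField.discr K).natAbs = mW) →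
    (∀ a : ZMod mW, χW a = χE (a.val : ZMod mE) * εK (a.val : ZMod (NumberField.discr K).natAbs)) →
    -- `reg(e)`: the class regularity number of `W`'s class `(p, mW, χW, k = (p+1)/4)`
    ¬ ‖((p - (p + 1) / 4 : ℕ) : ℚ_[p])⁻¹ * generalizedBernoulli (p - (p + 1) / 4) χW‖ ≤ (p : ℝ)⁻¹ →
    -- the stripped partner's number `B_{k,χ_c}/k`
    ¬ ‖(((p + 1) / 4 : ℕ) : ℚ_[p])⁻¹ * generalizedBernoulli ((p + 1) / 4) χE‖ ≤ (p : ℝ)⁻¹ →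
    BSDp W p

/-! ## §1 P1 — Kriz–Li Thm. 1.20 at `(X₀(49), 7, ω²)` over a GENERAL Heegner field `K`, from class regularity -/

/-- **The Bernoulli hypothesis of Thm. 1.20 for `(X₀(49), 7, ψ = ω², K)` IS class regularity.** For any
imaginary quadratic `K` with the Heegner hypothesis for `49` (so `7 ∤ d_K`), its Kronecker character `ε_K`
(primitive mod `|d_K|`) and any Teichmüller `ω` mod `7`:
`7 ∣ B_{1,ψ₀⁻¹ε_K}·B_{1,ψ₀ω⁻¹} ⟺ 7 ∣ B_{5,ε_K}/5` — the second factor is `B_{1,ω}`, a `7`-unit for every `K`;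
the first is `B_{1,ε_K ω⁴} ≡ B_{5,ε_K}/5 (mod 7)` (χ-twisted Kummer congruence, `j = 4 ≤ p − 3`).
[cite: KrizLi2019, Thm. 1.20 (p. 8, the Bernoulli hypothesis)] [cite: Washington1997, Thm. 5.11, Cor. 5.13 and §5.1] -/
theorem bernoulli_hypothesis_cm7_iff_regular (K : Type) [Field K] [NumberField K]
    [NeZero (NumberField.discr K).natAbs] (hK : IsImaginaryQuadratic K) (hH : SatisfiesHeegnerHypothesis 49 K)
    (εK : DirichletCharacter ℚ_[7] (NumberField.discr K).natAbs) (hεK : IsKroneckerCharacterOf K εK)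
    (ω : DirichletCharacter ℚ_[7] 7) (hω : IsTeichmullerCharacter ω) :
    ‖bernoulliOnePrim (bernoulliCharOne (ω ^ 2) εK) * bernoulliOnePrim (bernoulliCharTwo (ω ^ 2) εK ω)‖ ≤
        ((7 : ℕ) : ℝ)⁻¹ ↔
      ‖(5 : ℚ_[7])⁻¹ * generalizedBernoulli 5 εK‖ ≤ (7 : ℝ)⁻¹ := by
  haveI : Fact (Nat.Prime 7) := ⟨by norm_num⟩
  have h7 : Nat.Prime 7 := by norm_num
  -- `7 ∤ d_K` (a prime dividing the level splits, hence is unramified)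
  have h7d : ¬ 7 ∣ (NumberField.discr K).natAbs := fun h =>
    Literature.SatisfiesHeegnerHypothesis.not_dvd_discr hK.1 hH h7 (by norm_num) (Int.ofNat_dvd_left.mpr h)
  have hd7 : (NumberField.discr K).natAbs.Coprime 7 := ((Nat.Prime.coprime_iff_not_dvd h7).mpr h7d).symm
  -- values of `ψ₀⁻¹ε_K = ε_K↑·(ω⁴)↑` at the primes `ℓ ∤ 7·d_K`
  have hN₀ : 7 * (NumberField.discr K).natAbs ≠ 0 :=
    mul_ne_zero (by norm_num) (NeZero.ne (NumberField.discr K).natAbs)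
  have hΨ : ∀ ℓ : ℕ, ℓ.Prime → ¬ ℓ ∣ 7 * (NumberField.discr K).natAbs →
      bernoulliCharOne (ω ^ 2) εK (ℓ : ZMod (7 * (NumberField.discr K).natAbs)) =
        εK (ℓ : ZMod (NumberField.discr K).natAbs) * ω (ℓ : ZMod 7) ^ 4 := by
    intro ℓ hℓ hℓN
    rw [bernoulliCharOne_teichmuller_sq]
    exact KrizLiBinders.psi_apply_natCast_of_coprime ω εK 4 (by norm_num)
      ((Nat.Prime.coprime_iff_not_dvd hℓ).mpr hℓN)
  have hiff := KummerDictionary.norm_bernoulliOnePrim_le_inv_iff_of_values (p := 7) hd7 εK hεK.1 hω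
    (j := 4) (by norm_num) (by norm_num) (bernoulliCharOne (ω ^ 2) εK) hN₀ hΨ
  rw [norm_mul, norm_bernoulliOnePrim_bernoulliCharTwo_teichmuller_sq ω hω εK, mul_one, hiff]
  norm_num

/-- **P1, log form. Kriz–Li Thm. 1.20 at `(X₀(49), 7, ω²)` over a general Heegner field, from class regularity.**
Granted the named fact `KrizLi2019.thm120_padicLogHeegner_unit_of_bernoulli` (refereed, FMS 7 (2019) e15): for EVERY
imaginary quadratic `K` with the Heegner hypothesis for `49` whose Kronecker character satisfies `7 ∤ B_{5,ε_K}/5`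
(class regularity, the `K''`-free factor), every parametrisation datum `Dt` of `X₀(49)` of level `N = 49`, every
Heegner datum `H`, every embedding `ιp : K → ℚ₇` and the Heegner point `P`:
`(|Ẽ^{ns}(𝔽₇)|/7)·(log_{ω_𝓔} P / c(Dt)) ≢ 0 (mod 7)` — the conclusion of Thm. 1.20 verbatim. Instantiation as in
bsd-goldfeld's T1 (`E[7]^{ss} = 𝔽₇(ω²) ⊕ 𝔽₇(ω⁵)`, (1) `ψ(7) = 0 ≠ 1`, `(ψ⁻¹ω)(7) ≠ 1`, (2) CM ⇒ no multiplicative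
prime, (3) vacuous, `p = 7` additive — allowed, Rem. 1.21); the ONLY change is the Bernoulli binder, now
`bernoulli_hypothesis_cm7_iff_regular` instead of a per-`q` certificate, so `d_K` is unrestricted.
[cite: KrizLi2019, Thm. 1.20 (pp. 7–8) = Thm. 7.1, Rem. 1.21 (p. 8)] [cite: Washington1997, Thm. 5.11 and §5.1] -/
theorem padicLogHeegner_unit_cm7_of_regular (h120 : thm120_padicLogHeegner_unit_of_bernoulli)
    (K : Type) [Field K] [NumberField K] [NeZero (NumberField.discr K).natAbs]
    (hK : IsImaginaryQuadratic K) (hH : SatisfiesHeegnerHypothesis 49 K)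
    (εK : DirichletCharacter ℚ_[7] (NumberField.discr K).natAbs) (hεK : IsKroneckerCharacterOf K εK)
    (hreg : ¬ ‖(5 : ℚ_[7])⁻¹ * generalizedBernoulli 5 εK‖ ≤ (7 : ℝ)⁻¹)
    {N : ℕ} [NeZero N] (hN : N = 49) (Dt : ModularParametrizationData cm7 N)
    (H : HeegnerDatum N (NumberField.discr K)) (ι : K →+* ℂ) (ιp : K →+* ℚ_[7])
    (P : (cm7.baseChange K).toAffine.Point)
    (hPH : WeierstrassCurve.Affine.Point.map ι.toRatAlgHom P = heegnerPointComplex Dt H) :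
    ¬ (‖((nsPointCount cm7 7 : ℤ) : ℚ_[7]) / ((7 : ℕ) : ℚ_[7]) *
          (Castella2018.padicLogOmega cm7 7 ιp P / (Dt.maninConstant : ℚ_[7]))‖ ≤ ((7 : ℕ) : ℝ)⁻¹) := by
  haveI : Fact (Nat.Prime 7) := ⟨by norm_num⟩
  have e : N = cm7.conductorNorm ℤ := hN.trans conductorNorm_cm7.symm
  subst e
  have hH' : SatisfiesHeegnerHypothesis (cm7.conductorNorm ℤ) K := by rw [conductorNorm_cm7]; exact hH
  have h7K : ((Ideal.span {((7 : ℕ) : ℤ)}).primesOver (𝓞 K)).ncard = 2 := hH 7 (by norm_num) (by norm_num)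
  obtain ⟨ω, hω⟩ := exists_isTeichmullerCharacter (p := 7)
  have hB : ¬ (‖bernoulliOnePrim (bernoulliCharOne (ω ^ 2) εK) *
      bernoulliOnePrim (bernoulliCharTwo (ω ^ 2) εK ω)‖ ≤ ((7 : ℕ) : ℝ)⁻¹) := by
    rw [bernoulli_hypothesis_cm7_iff_regular K hK hH εK hεK ω hω]
    exact hreg
  exact h120 7 (by norm_num) cm7 7 (ω ^ 2) ω (teichmuller_sq_isPrimitive ω hω) hω
    (hss_cm7_teichmuller_sq ω hω) (teichmuller_sq_apply_seven_ne_one ω)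
    (primVal_invMulOmega_teichmuller_sq_seven_ne_one ω hω)
    (not_hasSplitMultiplicativeReductionAtPrime_of_hasCM cm7 hasCM_cm7')
    (fun ℓ hℓ h7 hbad => by
      haveI := Fact.mk hℓ
      exact absurd (hasGoodReductionAtPrime_cm7 ℓ h7) hbad.1)
    Dt K hK hH' h7K εK hεK H ι ιp P hPH hB

/-- **P1, rank form (critic V#146's `heegnerPoint_cm7_not_isOfFinAddOrder_of_regular`). Every level-`49` Heegner point
of `X₀(49)` over a REGULAR Heegner field has infinite order.** For every imaginary quadratic `K` with the Heegner
hypothesis for `49` and `7 ∤ B_{5,ε_K}/5`, granted Kriz–Li Thm. 1.20: `IsHeegnerPoint 49 cm7 K P → ¬ IsOfFinAddOrder P`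
(any datum, any Manin constant). Proof: the log form at the embedding `K ↪ K_𝔭 = ℚ₇` of a degree-one prime `𝔭 ∣ 7`
(`X11b.embAt`; `7` splits), `log ≠ 0` (`padicLogOmega_ne_zero_of_not_norm_le`), and the formal logarithm kills exactly
the torsion (`X11b.R1.logOmega_eq_zero_iff`). The `K`-general twin of `not_isOfFinAddOrder_heegnerPoint_cm7_of_thm120`
(there: `d_K = −4q` and a per-`q` certificate). [cite: KrizLi2019, Thm. 1.20 (pp. 7–8), Rem. 1.21]
[cite: SilvermanAEC2009, IV.6.4 and VII.6.3] -/
theorem not_isOfFinAddOrder_heegnerPoint_cm7_of_regular (h120 : thm120_padicLogHeegner_unit_of_bernoulli)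
    (K : Type) [Field K] [NumberField K] [NeZero (NumberField.discr K).natAbs]
    (hK : IsImaginaryQuadratic K) (hH : SatisfiesHeegnerHypothesis 49 K)
    (εK : DirichletCharacter ℚ_[7] (NumberField.discr K).natAbs) (hεK : IsKroneckerCharacterOf K εK)
    (hreg : ¬ ‖(5 : ℚ_[7])⁻¹ * generalizedBernoulli 5 εK‖ ≤ (7 : ℝ)⁻¹)
    {P : (cm7.baseChange K).toAffine.Point} (hP : IsHeegnerPoint 49 cm7 K P) : ¬ IsOfFinAddOrder P := by
  haveI : Fact (Nat.Prime 7) := ⟨by norm_num⟩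
  have h7K : ((Ideal.span {((7 : ℕ) : ℤ)}).primesOver (𝓞 K)).ncard = 2 := hH 7 (by norm_num) (by norm_num)
  obtain ⟨𝔭, h𝔭, he, hf⟩ := X11b.exists_degreeOnePrime_of_splitsIn K 7 hK.1 h7K
  obtain ⟨Dt, H, ι, hPH⟩ := hP
  have key := padicLogHeegner_unit_cm7_of_regular h120 K hK hH εK hεK hreg rfl Dt H ι
    (X11b.embAt K 7 𝔭 h𝔭 he hf) P hPH
  have hlog := padicLogOmega_ne_zero_of_not_norm_le key
  exact fun hfin => hlog ((X11b.R1.logOmega_eq_zero_iff cm7 7 (X11b.embAt K 7 𝔭 h𝔭 he hf) P).mpr hfin)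

/-! ## §2 P2 — the ONE new piece of the assembly, typed (OPEN; a predicate, nothing asserted) -/

/-- **P2 STUB (OPEN) `IndexIdentityAtCm7SevenOfLogUnit` — the `7`-part of the Heegner-index identity over `K` for
`X₀(49)` from the unit logarithm.** For `K` imaginary quadratic with the Heegner hypothesis for `49`, a level-`49`
parametrisation datum `Dt` with `7 ∤ c(Dt)`, its Heegner point `P ∈ X₀(49)(K)` with UNIT `7`-adic logarithm
(the conclusion of §1 at some `ιp`), `rank_ℤ X₀(49)(K) = 1` (Gross–Zagier–Kolyvagin, supplied by the consumer) and
`7 ∤ #Ш(X₀(49)/K)` (supplied OUTSIDE the stub: `Ш(E/K)[7^∞] ≅ Ш(49a1)[7^∞] ⊕ Ш(W)[7^∞]` for odd `d_K`, `7 ∤ #Ш(49a1)`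
from `BSD(49a1,7)` in rank `0`, `7 ∤ #Ш(W)` from the cell's regular-member Selmer count + rank one):
`X11b.IndexIdentityAt cm7 7 K P`, i.e. `2·ord₇ ∏c_ℓ(49a1) + ord₇ #Ш(E/K) = 2·ord₇ [E(K) : ℤP]`. Content left to
prove (M-sized, all classical): `ord₇ ∏c_ℓ(49a1) = 0` (`c₇ = 2`); `7 ∤ #X₀(49)(K)_tors`
(`GoldfeldGoodTwists.torsionOrder_cm7_baseChange_eq_two_of_not_isSquare`); and UNIT LOG ⟹ `P ∉ 7·E(K) + E(K)_tors`
(`log` is `ℤ`-linear, kills torsion, and `ord₇ log_ω Q ≥ 0` on `E(ℚ₇)` since `[E(ℚ₇) : E₁(ℚ₇)] = c₇·|Ẽ^{ns}(𝔽₇)| = 14`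
and `log E₁(ℚ₇) = 7ℤ₇`), whence `7 ∤ [E(K) : ℤP]`. This is the `hid` binder of
`EisensteinPrimesMazurMCOnCellBTwistbackDisplay.displaySwap_of_indexIdentityAt` at `(W, p, N) = (cm7, 7, 49)`.
[cite: KrizLi2019, Thm. 1.20 and §7 (p ∤ the Heegner index in the rank-one case)] [cite: GrossLMS1991, §2 Conj. (2.2)]
[cite: Castella2018, (5.3) (p. 12)] [cite: SilvermanAEC2009, IV.6.4, VII.6.3] -/
def IndexIdentityAtCm7SevenOfLogUnit : Prop :=
  ∀ (K : Type) [Field K] [NumberField K],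
    IsImaginaryQuadratic K → SatisfiesHeegnerHypothesis 49 K →
    ∀ (Dt : ModularParametrizationData cm7 49) (H : HeegnerDatum 49 (NumberField.discr K)) (ι : K →+* ℂ)
      (ιp : K →+* ℚ_[7]) (P : (cm7.baseChange K).toAffine.Point),
      WeierstrassCurve.Affine.Point.map ι.toRatAlgHom P = heegnerPointComplex Dt H →
      ¬ (7 : ℤ) ∣ Dt.maninConstant →
      ¬ (‖((nsPointCount cm7 7 : ℤ) : ℚ_[7]) / ((7 : ℕ) : ℚ_[7]) *
            (Castella2018.padicLogOmega cm7 7 ιp P / (Dt.maninConstant : ℚ_[7]))‖ ≤ ((7 : ℕ) : ℝ)⁻¹) →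
      (cm7.baseChange K).mordellWeilRank = 1 →
      padicValNat 7 (cm7.baseChange K).shaOrder = 0 →
      X11b.IndexIdentityAt cm7 7 K P

end Summit.BirchSwinnertonDyer.BirchSwinnertonDyer.Cruxes.BottomClassIndexLawFiveLe.GenusInternalHeegnerFields

end
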